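import Summits.BirchSwinnertonDyer.BirchSwinnertonDyer.Theses.AdditiveBranchIMC

/-!
# K1 route `AdditiveBranchIMC` — parity glue for the split crux `GordTwoRankZeroOffCaseOne`

Item `stmt-BirchSwinnertonDyer-19246` (support, glue of the gen-1 tenure split of crux 19357):
`GordTwoRankZeroOffCaseOneGlue := GordTwoRankZeroOffCaseOneEven → GordTwoRankZeroOffCaseOneOdd →
GordTwoRankZeroOffCaseOne`.

The two children are the parent restricted to `p % 4 = 1` resp. `p % 4 = 3`; the cell predicate
`N10.CellGordTwo W p` carries `p ≠ 2`, and an odd prime is `≡ 1` or `≡ 3 (mod 4)`, so the glue is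
pure logic. The proof is the planner's sketch (`planner/split19357/SketchSplit.lean`,
`gordTwoRankZeroOffCaseOne_of_even_of_odd`, bsd-addord-plan g13) landed verbatim against the route
declaration.

No mathematics of the crux is touched here: the children 19244 / 19245 remain open.
-/

set_option autoImplicit false
set_option linter.dupNamespace false

namespace Summit.BirchSwinnertonDyer.BirchSwinnertonDyer.Theorems.AdditiveBranchIMCGordTwo

open Summit.BirchSwinnertonDyer.BirchSwinnertonDyer.Theses.AdditiveBranchIMC

/-- **Glue item 19246, proved outright.** `Even → Odd → GordTwoRankZeroOffCaseOne`: for an odd prime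
`p` (oddness from `N10.CellGordTwo W p`, whose first clause is `p ≠ 2`) either `p % 4 = 1`, handled by
the even-branch child, or `p % 4 = 3`, handled by the odd-branch child. Planner sketch
`gordTwoRankZeroOffCaseOne_of_even_of_odd` verbatim. -/
theorem gordTwoRankZeroOffCaseOneGlue_proof : GordTwoRankZeroOffCaseOneGlue := by
  unfold GordTwoRankZeroOffCaseOneGlue
  intro hEven hOdd W _ _ p _ hr hc hno
  have h4 : p % 4 = 1 ∨ p % 4 = 3 := by
    have := Nat.odd_iff.mp ((Fact.out : p.Prime).odd_of_ne_two hc.1); omega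
  rcases h4 with h1 | h3
  · exact hEven W p hr hc hno h1
  · exact hOdd W p hr hc hno h3

end Summit.BirchSwinnertonDyer.BirchSwinnertonDyer.Theorems.AdditiveBranchIMCGordTwo
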